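import Mathlib
import HarnessLib
import Literature.Analysis.ODE.LogConvexityBackwardUniqueness

/-!
# Route `QuarterLogPincer`, crux `TypeIQuantSubcubicExp` (stmt-NavierStokesRegularity-24077), line `silencing_cost` —
# ANNEX: the QUANTITATIVE log-convexity core of Sc′ `ThickBoxSilencingCost` (real-variable half, PROVED)

ns-idea-7 g13 (lens «nearmiss»).  The stub Sc′ `LimitSilence.ThickBoxSilencingCost` (= `SilencingCost`'s Sc′; tree
`…Theorems.QuarterLogPincerLimitSilenceDefs`) asks for a FLOOR `c(B,δ,Γ₂)/σ` under the local enstrophy one clock unit after it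
was `≥ δ/σ`, for the parabolic-inequality class with the thick-box bounds.  Its card (`Lines/silencing-cost.md`) defends it by the
Gaussian-weighted Dirichlet quotient (Bardos–Tartar / Poon) with «constants sketched».  The argument has two halves:
(PDE) for the backward-heat-kernel-weighted, cut-off energy `H(s) = ∫ η²G|ω|²` and Dirichlet form `D(s) = ∫ η²G|∇ω|²`
(`G` centred at `(y, t₁ + a)`), the energy inequality `H' ≥ −(αV + βH)` and the Riccati law `V'H − VH' ≤ K(V + H)H` for
`V = (t₁ + a − s)D` hold up to a cut-off leak that the thick box makes absolutely small (`B²K³e^{−K²/(4(1+a))}`);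
(ODE) from the two inequalities, POSITIVITY PROPAGATES QUANTITATIVELY:
`H(t) ≥ H(t₀)·exp(−(α(Λ₀ + 1)e^{K(t−t₀)} + β)(t − t₀))`, `Λ₀ = V(t₀)/H(t₀)` — the floor, with every constant explicit.
v1.1: + ★★ `floor_of_dirichletQuotient_law_leak` — the same floor when both inequalities carry ABSOLUTE leaks `ℓ, L ≥ 0`
(`E' ≥ −(αV+βE) − ℓ`, `V'E − VE' ≤ (K(V+E) + L)E`): any level `m` strictly below the homogeneous floor computed with
`K' = K + L/m`, `β' = |β| + ℓ/m` is never reached on the window (continuity bootstrap: while `E ≥ m` the leaks are relatively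
bounded).  This is exactly the form the cut-off Poon/Ornstein–Uhlenbeck computation delivers (PLAN in `Lines/silencing-cost.md`
v1.4 §Q): in similarity variables `ξ = x/√(t₁+1−s)`, `τ = log((t₁+1)/(t₁+1−s))` the backward-heat-kernel weight becomes the fixed
Gaussian measure `ρ = e^{−|ξ|²/4}` and `−Δ` becomes the Ornstein–Uhlenbeck operator `A = −Δ_ξ + ½ξ·∇_ξ`, symmetric and `≥ 0` on
`L²(ρ)` with `⟨AW,W⟩_ρ = ∫|∇W|²ρ`; the parabolic inequality becomes `‖W' + AW‖ ≤ √2·B‖∇W‖ + 2B‖W‖` pointwise on the (growing)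
box, so Temam's Lemma 6.1 computation gives the two laws with `α = 2 + √2B`, `β = √2B + 4B`, `K = 4·max(2B², 4B²)`, up to
cut-off leaks supported on the shell, bounded absolutely by `C·B²K³e^{−K²/16}` thanks to the thick-box bounds — and the initial
quotient `Λ₀ ≤ C·B²e^{Γ₂²/4}/δ` is INDEPENDENT of `K`, so the floor is `K`-independent and `K = K(B,δ,Γ₂)` is chosen last to sink
the leaks (a FIXED-width Gaussian does NOT work: its drift commutator costs `k ∼ K/L` against a suppression `e^{−K²/L}` and a
quotient `Λ₀ ∼ L^{3/2}/δ`, with no consistent `(K, L)` for small `δ` — recorded in the card).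
The tree holds the QUALITATIVE form of (ODE) (`Literature.Analysis.ODE.eq_zero_of_dirichletQuotient_law` /
`pos_of_dirichletQuotient_law`, Temam 1997 Ch. III Lemma 6.2); this annex PROVES the quantitative form ★
`mul_exp_neg_le_of_dirichletQuotient_law` under literally the same hypotheses (one-sided derivatives within `[a,b]`, the two
inequalities only where `E > 0`), by the same two monotonicity steps (`(Λ+1)e^{−Ks}` non-increasing, `E e^{Ms}` non-decreasing,
`M = α(Λ₀+1)e^{K(t−t₀)} + β`) run on `[t₀, t]`, where `E > 0` throughout by the qualitative lemma.  Port target (typer's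
choice): `Literature/Analysis/ODE/LogConvexityQuantitative.lean` (namespace `Literature.Analysis.ODE`) or a `Theorems/QuarterLogPincer
SilencingCost…` file; here it sits in the line's namespace.  `lean check`: rc 0 · sorries 0.
HONEST FRAME: a real-variable lemma; the PDE half of Sc′ (the weighted identities and the leak bookkeeping) is NOT done here;
nothing here bears on 24077's truth, W7 or Navier–Stokes regularity (OPEN / not proved).  No summit is proved by any line.
Sources: Temam 1997 Ch. III §6.1 (6.9)–(6.14) [Temam1997]; Constantin–Foias 1988 Thm 12.2; Bardos–Tartar ARMA 50 (1973);
Poon, Comm. PDE 21 (1996) Thm 1.1.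
-/

set_option linter.dupNamespace false

noncomputable section

open Set Filter Topology

namespace Summit.NavierStokesRegularity.NavierStokesRegularity.Cruxes.TypeIQuantSubcubicExp.SilencingCost

/-- ★ **Quantitative positivity propagation by log-convexity** (Temam 1997 Ch. III Lemma 6.2, quantitative reading of
(6.12)–(6.14)).  Let `E, V ≥ 0` have one-sided derivatives `E', V'` within `[a,b]`, and suppose that wherever `E > 0` the
energy inequality `E' ≥ −(αV + βE)` and the Dirichlet-quotient law `V'E − VE' ≤ K(V + E)E` hold (`K, α ≥ 0`).  If
`E(t₀) > 0` then for every `t ∈ [t₀, b]`: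
`E(t) ≥ E(t₀) · exp(−(α·(V(t₀)/E(t₀) + 1)·e^{K(t − t₀)} + β)·(t − t₀))`. -/
theorem mul_exp_neg_le_of_dirichletQuotient_law {a b K α β : ℝ} {E V E' V' : ℝ → ℝ}
    (hE : ∀ t ∈ Icc a b, HasDerivWithinAt E (E' t) (Icc a b) t)
    (hV : ∀ t ∈ Icc a b, HasDerivWithinAt V (V' t) (Icc a b) t)
    (hE0 : ∀ t ∈ Icc a b, 0 ≤ E t) (hV0 : ∀ t ∈ Icc a b, 0 ≤ V t) (hK : 0 ≤ K) (hα : 0 ≤ α)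
    (hlow : ∀ t ∈ Icc a b, 0 < E t → -(α * V t + β * E t) ≤ E' t)
    (hquot : ∀ t ∈ Icc a b, 0 < E t → V' t * E t - V t * E' t ≤ K * (V t + E t) * E t)
    {t₀ : ℝ} (ht₀ : t₀ ∈ Icc a b) (hpos : 0 < E t₀) {t : ℝ} (ht : t ∈ Icc a b) (ht₀t : t₀ ≤ t) :
    E t₀ * Real.exp (-((α * ((V t₀ / E t₀ + 1) * Real.exp (K * (t - t₀))) + β) * (t - t₀))) ≤ E t := by
  rcases eq_or_lt_of_le ht₀t with heq | ht₀t₁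
  · subst heq
    simp
  -- notation: `t₁ := t`
  set t₁ : ℝ := t with ht₁_def
  have hEc : ContinuousOn E (Icc a b) := fun s hs => (hE s hs).continuousWithinAt
  have hVc : ContinuousOn V (Icc a b) := fun s hs => (hV s hs).continuousWithinAt
  have hIsub : Icc t₀ t₁ ⊆ Icc a b := fun s hs => ⟨ht₀.1.trans hs.1, hs.2.trans ht.2⟩
  -- `E > 0` on `[t₀, t₁]` (qualitative lemma)
  have hEpos : ∀ s ∈ Icc t₀ t₁, 0 < E s := fun s hs =>
    Literature.Analysis.ODE.pos_of_dirichletQuotient_law hE hV hE0 hV0 hK hα hlow hquot ht₀ hpos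
      (hIsub hs) hs.1
  -- two-sided derivatives at interior points
  have hnhds : ∀ s ∈ Ioo t₀ t₁, Icc a b ∈ 𝓝 s := fun s hs =>
    Icc_mem_nhds (ht₀.1.trans_lt hs.1) (hs.2.trans_le ht.2)
  have hEd : ∀ s ∈ Ioo t₀ t₁, HasDerivAt E (E' s) s := fun s hs =>
    (hE s (hIsub (Ioo_subset_Icc_self hs))).hasDerivAt (hnhds s hs)
  have hVd : ∀ s ∈ Ioo t₀ t₁, HasDerivAt V (V' s) s := fun s hs =>
    (hV s (hIsub (Ioo_subset_Icc_self hs))).hasDerivAt (hnhds s hs)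
  -- Step 1: `(Λ + 1) e^{-Ks}` is non-increasing on `[t₀, t₁]`, `Λ = V/E`.
  set Λ : ℝ → ℝ := fun s => V s / E s with hΛ_def
  set F : ℝ → ℝ := fun s => (Λ s + 1) * Real.exp (-(K * s)) with hF_def
  set F' : ℝ → ℝ := fun s =>
    ((V' s * E s - V s * E' s) / E s ^ 2 - K * (Λ s + 1)) * Real.exp (-(K * s)) with hF'_def
  have hFd : ∀ s ∈ Ioo t₀ t₁, HasDerivAt F (F' s) s := by
    intro s hs
    have hEs : E s ≠ 0 := (hEpos s (Ioo_subset_Icc_self hs)).ne'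
    have hΛd : HasDerivAt Λ ((V' s * E s - V s * E' s) / E s ^ 2) s :=
      (hVd s hs).div (hEd s hs) hEs
    have hexp : HasDerivAt (fun y => Real.exp (-(K * y))) (Real.exp (-(K * s)) * -(K * 1)) s :=
      ((hasDerivAt_id' s).const_mul K).neg.exp
    have h := (hΛd.add_const 1).mul hexp
    refine h.congr_deriv ?_
    simp only [hF'_def]
    ring
  have hFsign : ∀ s ∈ Ioo t₀ t₁, F' s ≤ 0 := by
    intro s hs
    have hEs : 0 < E s := hEpos s (Ioo_subset_Icc_self hs)
    have hq := hquot s (hIsub (Ioo_subset_Icc_self hs)) hEs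
    have h1 : (V' s * E s - V s * E' s) / E s ^ 2 ≤ K * (Λ s + 1) := by
      rw [div_le_iff₀ (pow_pos hEs 2)]
      have e : K * (Λ s + 1) * E s ^ 2 = K * (V s + E s) * E s := by
        simp only [hΛ_def]
        field_simp
      rw [e]
      exact hq
    exact mul_nonpos_of_nonpos_of_nonneg (by linarith) (Real.exp_pos _).le
  have hF : AntitoneOn F (Icc t₀ t₁) := by
    have hΛc : ContinuousOn Λ (Icc t₀ t₁) :=
      (hVc.mono hIsub).div (hEc.mono hIsub) fun s hs => (hEpos s hs).ne'
    have hcont : ContinuousOn F (Icc t₀ t₁) :=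
      (hΛc.add continuousOn_const).mul
        ((continuous_const.mul continuous_id').neg.rexp).continuousOn
    refine antitoneOn_of_hasDerivWithinAt_nonpos (f' := F') (convex_Icc t₀ t₁) hcont ?_ ?_
    · intro s hs
      rw [interior_Icc] at hs ⊢
      exact (hFd s hs).hasDerivWithinAt
    · intro s hs
      rw [interior_Icc] at hs
      exact hFsign s hs
  -- hence `Λ ≤ B - 1 ≤ B` on `[t₀, t₁]`, `B = (Λ₀ + 1)e^{K(t₁ - t₀)}`
  set B : ℝ := (Λ t₀ + 1) * Real.exp (K * (t₁ - t₀)) with hB_def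
  have hΛ0 : 0 ≤ Λ t₀ := div_nonneg (hV0 t₀ ht₀) hpos.le
  have hΛB : ∀ s ∈ Icc t₀ t₁, Λ s ≤ B := by
    intro s hs
    have h1 : F s ≤ F t₀ := hF (left_mem_Icc.2 ht₀t₁.le) hs hs.1
    have h2 : (Λ s + 1) * Real.exp (-(K * s)) ≤ (Λ t₀ + 1) * Real.exp (-(K * t₀)) := h1
    have hexp : Real.exp (-(K * t₀)) = Real.exp (K * (s - t₀)) * Real.exp (-(K * s)) := by
      rw [← Real.exp_add]
      congr 1
      ring
    rw [hexp, ← mul_assoc] at h2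
    have h3 : Λ s + 1 ≤ (Λ t₀ + 1) * Real.exp (K * (s - t₀)) :=
      le_of_mul_le_mul_right h2 (Real.exp_pos _)
    have h4 : Real.exp (K * (s - t₀)) ≤ Real.exp (K * (t₁ - t₀)) :=
      Real.exp_le_exp.2 (mul_le_mul_of_nonneg_left (by linarith [hs.2]) hK)
    have h5 : (Λ t₀ + 1) * Real.exp (K * (s - t₀)) ≤ B :=
      mul_le_mul_of_nonneg_left h4 (by linarith)
    linarith
  -- Step 2: `E e^{Ms}` is non-decreasing on `[t₀, t₁]`, `M = αB + β`.
  set M : ℝ := α * B + β with hM_def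
  set G : ℝ → ℝ := fun s => E s * Real.exp (M * s) with hG_def
  set G' : ℝ → ℝ := fun s => (E' s + M * E s) * Real.exp (M * s) with hG'_def
  have hGd : ∀ s ∈ Ioo t₀ t₁, HasDerivAt G (G' s) s := by
    intro s hs
    have hexp : HasDerivAt (fun y => Real.exp (M * y)) (Real.exp (M * s) * (M * 1)) s :=
      ((hasDerivAt_id' s).const_mul M).exp
    refine ((hEd s hs).mul hexp).congr_deriv ?_
    simp only [hG'_def]
    ring
  have hGsign : ∀ s ∈ Ioo t₀ t₁, 0 ≤ G' s := by
    intro s hs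
    have hs' : s ∈ Icc a b := hIsub (Ioo_subset_Icc_self hs)
    have hEs : 0 < E s := hEpos s (Ioo_subset_Icc_self hs)
    have hl := hlow s hs' hEs
    have hVeq : V s = Λ s * E s := by
      simp only [hΛ_def]
      field_simp
    have hVle : V s ≤ B * E s := by
      rw [hVeq]
      exact mul_le_mul_of_nonneg_right (hΛB s (Ioo_subset_Icc_self hs)) hEs.le
    have h1 : 0 ≤ E' s + M * E s := by
      have : α * V s ≤ α * (B * E s) := mul_le_mul_of_nonneg_left hVle hα
      simp only [hM_def]
      nlinarith
    exact mul_nonneg h1 (Real.exp_pos _).le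
  have hG : MonotoneOn G (Icc t₀ t₁) := by
    have hcont : ContinuousOn G (Icc t₀ t₁) :=
      (hEc.mono hIsub).mul ((continuous_const.mul continuous_id').rexp).continuousOn
    refine monotoneOn_of_hasDerivWithinAt_nonneg (f' := G') (convex_Icc t₀ t₁) hcont ?_ ?_
    · intro s hs
      rw [interior_Icc] at hs ⊢
      exact (hGd s hs).hasDerivWithinAt
    · intro s hs
      rw [interior_Icc] at hs
      exact hGsign s hs
  -- Step 3: `E(t₀) e^{Mt₀} ≤ E(t₁) e^{Mt₁}`.
  have h1 : G t₀ ≤ G t₁ := hG (left_mem_Icc.2 ht₀t₁.le) (right_mem_Icc.2 ht₀t₁.le) ht₀t₁.le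
  have h2 : E t₀ * Real.exp (M * t₀) ≤ E t₁ * Real.exp (M * t₁) := h1
  have hexp : Real.exp (-(M * (t₁ - t₀))) = Real.exp (M * t₀) * (Real.exp (M * t₁))⁻¹ := by
    rw [← Real.exp_neg, ← Real.exp_add]
    congr 1
    ring
  have hgoal : E t₀ * Real.exp (-(M * (t₁ - t₀))) ≤ E t₁ := by
    rw [hexp, ← mul_assoc, mul_inv_le_iff₀ (Real.exp_pos _)]
    exact h2
  -- the displayed constant is `M` by definition of `B`, `Λ`
  convert hgoal using 3

/-- The same floor with a UNIFORM rate on a window of length `≤ τ`: if `t − t₀ ≤ τ` then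
`E(t) ≥ E(t₀)·exp(−(α(Λ₀+1)e^{Kτ} + |β|)·τ)` — the form used for Sc′ (one clock unit, `τ = σ²` after rescaling `τ = 1`). -/
theorem mul_exp_neg_le_of_dirichletQuotient_law_uniform {a b K α β τ : ℝ} {E V E' V' : ℝ → ℝ}
    (hE : ∀ t ∈ Icc a b, HasDerivWithinAt E (E' t) (Icc a b) t)
    (hV : ∀ t ∈ Icc a b, HasDerivWithinAt V (V' t) (Icc a b) t)
    (hE0 : ∀ t ∈ Icc a b, 0 ≤ E t) (hV0 : ∀ t ∈ Icc a b, 0 ≤ V t) (hK : 0 ≤ K) (hα : 0 ≤ α)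
    (hlow : ∀ t ∈ Icc a b, 0 < E t → -(α * V t + β * E t) ≤ E' t)
    (hquot : ∀ t ∈ Icc a b, 0 < E t → V' t * E t - V t * E' t ≤ K * (V t + E t) * E t)
    {t₀ : ℝ} (ht₀ : t₀ ∈ Icc a b) (hpos : 0 < E t₀) {t : ℝ} (ht : t ∈ Icc a b) (ht₀t : t₀ ≤ t)
    (hτ : t - t₀ ≤ τ) :
    E t₀ * Real.exp (-((α * ((V t₀ / E t₀ + 1) * Real.exp (K * τ)) + |β|) * τ)) ≤ E t := by
  have h := mul_exp_neg_le_of_dirichletQuotient_law hE hV hE0 hV0 hK hα hlow hquot ht₀ hpos ht ht₀t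
  refine le_trans ?_ h
  refine mul_le_mul_of_nonneg_left (Real.exp_le_exp.2 ?_) hpos.le
  have hΛ0 : 0 ≤ V t₀ / E t₀ + 1 := by
    have := div_nonneg (hV0 t₀ ht₀) hpos.le
    linarith
  have hd : 0 ≤ t - t₀ := by linarith
  have he : Real.exp (K * (t - t₀)) ≤ Real.exp (K * τ) :=
    Real.exp_le_exp.2 (mul_le_mul_of_nonneg_left hτ hK)
  have hA : 0 ≤ α * ((V t₀ / E t₀ + 1) * Real.exp (K * τ)) :=
    mul_nonneg hα (mul_nonneg hΛ0 (Real.exp_pos _).le)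
  have h1 : (α * ((V t₀ / E t₀ + 1) * Real.exp (K * (t - t₀))) + β) * (t - t₀)
      ≤ (α * ((V t₀ / E t₀ + 1) * Real.exp (K * τ)) + |β|) * (t - t₀) := by
    apply mul_le_mul_of_nonneg_right _ hd
    have : α * ((V t₀ / E t₀ + 1) * Real.exp (K * (t - t₀))) ≤ α * ((V t₀ / E t₀ + 1) * Real.exp (K * τ)) :=
      mul_le_mul_of_nonneg_left (mul_le_mul_of_nonneg_left he hΛ0) hα
    linarith [le_abs_self β]
  have h2 : (α * ((V t₀ / E t₀ + 1) * Real.exp (K * τ)) + |β|) * (t - t₀)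
      ≤ (α * ((V t₀ / E t₀ + 1) * Real.exp (K * τ)) + |β|) * τ :=
    mul_le_mul_of_nonneg_left hτ (add_nonneg hA (abs_nonneg β))
  linarith


/-- ★★ **Floor with an absolute LEAK (continuity bootstrap).**  Same setting, but the two inequalities carry absolute
inhomogeneities — the energy inequality `E' ≥ −(αV + βE) − ℓ` and the Riccati law `V'E − VE' ≤ (K(V + E) + L)E`
(`ℓ, L ≥ 0`; for Sc′ these are the cut-off leaks through the shell `Kσ ≤ |x − y| ≤ 2Kσ`, absolutely small by the thick-box
bounds and the Gaussian weight).  If a level `m > 0` lies STRICTLY BELOW the homogeneous floor computed with the enlarged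
constants `K' = K + L/m`, `β' = |β| + ℓ/m` on a window of length `τ`, i.e.
`m < E(t₀)·exp(−(α(Λ₀+1)e^{K'τ} + |β| + ℓ/m)·τ)`, then `E > m` on `[t₀, t₀ + τ] ∩ [a, b]`: while `E ≥ m` the leaks are
relatively bounded (`ℓ ≤ (ℓ/m)E`, `L·E ≤ (L/m)(V+E)E`), so the homogeneous lemma applies up to the first time `E` would touch
`m` — where it gives `E > m`, a contradiction. -/
theorem floor_of_dirichletQuotient_law_leak {a b K α β ℓ L m τ : ℝ} {E V E' V' : ℝ → ℝ}
    (hE : ∀ t ∈ Icc a b, HasDerivWithinAt E (E' t) (Icc a b) t)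
    (hV : ∀ t ∈ Icc a b, HasDerivWithinAt V (V' t) (Icc a b) t)
    (hE0 : ∀ t ∈ Icc a b, 0 ≤ E t) (hV0 : ∀ t ∈ Icc a b, 0 ≤ V t) (hK : 0 ≤ K) (hα : 0 ≤ α)
    (hℓ : 0 ≤ ℓ) (hL : 0 ≤ L) (hm : 0 < m)
    (hlow : ∀ t ∈ Icc a b, 0 < E t → -(α * V t + β * E t) - ℓ ≤ E' t)
    (hquot : ∀ t ∈ Icc a b, 0 < E t → V' t * E t - V t * E' t ≤ (K * (V t + E t) + L) * E t)
    {t₀ : ℝ} (ht₀ : t₀ ∈ Icc a b)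
    (hfloor : m < E t₀ * Real.exp (-((α * ((V t₀ / E t₀ + 1) * Real.exp ((K + L / m) * τ)) + |β| + ℓ / m) * τ)))
    {t : ℝ} (ht : t ∈ Icc a b) (ht₀t : t₀ ≤ t) (hτ : t - t₀ ≤ τ) :
    m < E t := by
  have hτ0 : 0 ≤ τ := le_trans (by linarith) hτ
  have hEc : ContinuousOn E (Icc a b) := fun s hs => (hE s hs).continuousWithinAt
  -- the rate is nonnegative, so `E t₀ > m`
  have hΛ0nn : 0 ≤ V t₀ / E t₀ + 1 := by
    have h0 : 0 ≤ V t₀ / E t₀ := by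
      rcases eq_or_lt_of_le (hE0 t₀ ht₀) with h | h
      · rw [← h]; simp
      · exact div_nonneg (hV0 t₀ ht₀) h.le
    linarith
  have hrate : 0 ≤ (α * ((V t₀ / E t₀ + 1) * Real.exp ((K + L / m) * τ)) + |β| + ℓ / m) * τ :=
    mul_nonneg (add_nonneg (add_nonneg (mul_nonneg hα (mul_nonneg hΛ0nn (Real.exp_pos _).le))
      (abs_nonneg β)) (div_nonneg hℓ hm.le)) hτ0
  have hEt₀ : m < E t₀ := by
    refine lt_of_lt_of_le hfloor ?_
    have : Real.exp (-((α * ((V t₀ / E t₀ + 1) * Real.exp ((K + L / m) * τ)) + |β| + ℓ / m) * τ)) ≤ 1 := by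
      rw [Real.exp_le_one_iff]; linarith
    exact le_trans (mul_le_mul_of_nonneg_left this (hE0 t₀ ht₀)) (by simp)
  by_contra hcon
  rw [not_lt] at hcon
  -- first time `t⋆ ∈ [t₀, t]` with `E ≤ m`
  set Z : Set ℝ := Icc t₀ t ∩ {s | E s ≤ m} with hZ_def
  have hsub0 : Icc t₀ t ⊆ Icc a b := fun s hs => ⟨ht₀.1.trans hs.1, hs.2.trans ht.2⟩
  have hZc : IsClosed Z := by
    have : Z = Icc t₀ t ∩ E ⁻¹' (Iic m) := by
      ext s; simp [hZ_def]
    rw [this]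
    exact (hEc.mono hsub0).preimage_isClosed_of_isClosed isClosed_Icc isClosed_Iic
  have hZne : Z.Nonempty := ⟨t, ⟨ht₀t, le_rfl⟩, hcon⟩
  have hZbdd : BddBelow Z := ⟨t₀, fun s hs => hs.1.1⟩
  set tS : ℝ := sInf Z with htS_def
  have htSZ : tS ∈ Z := hZc.csInf_mem hZne hZbdd
  have hEtS : E tS ≤ m := htSZ.2
  have ht₀tS : t₀ < tS := by
    rcases eq_or_lt_of_le htSZ.1.1 with h | h
    · rw [← h] at hEtS; exact absurd hEtS (not_le.2 hEt₀)
    · exact h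
  have htSt : tS ≤ t := htSZ.1.2
  have hIsub : Icc t₀ tS ⊆ Icc a b := fun s hs => hsub0 ⟨hs.1, hs.2.trans htSt⟩
  -- `E > m` on `[t₀, tS)`, hence `E ≥ m` on `[t₀, tS]`
  have hEgt : ∀ s ∈ Ico t₀ tS, m < E s := by
    intro s hs
    by_contra h'
    rw [not_lt] at h'
    have hsZ : s ∈ Z := ⟨⟨hs.1, hs.2.le.trans htSt⟩, h'⟩
    exact absurd (csInf_le hZbdd hsZ) (not_le.2 hs.2)
  have hEge : ∀ s ∈ Icc t₀ tS, m ≤ E s := by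
    intro s hs
    rcases eq_or_lt_of_le hs.2 with h | h
    · -- `s = tS`: by continuity from the left
      have hcl : closure (Ico t₀ tS) = Icc t₀ tS := closure_Ico ht₀tS.ne
      have hcont : ContinuousOn E (closure (Ico t₀ tS)) := by
        rw [hcl]; exact hEc.mono hIsub
      have := le_on_closure (f := fun _ => m) (g := E) (s := Ico t₀ tS) (fun x hx => (hEgt x hx).le)
        continuousOn_const hcont (x := s) (by rw [hcl]; exact hs)
      exact this
    · exact (hEgt s ⟨hs.1, h⟩).le
  have hEpos' : ∀ s ∈ Icc t₀ tS, 0 < E s := fun s hs => lt_of_lt_of_le hm (hEge s hs)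
  -- the homogeneous lemma on `[t₀, tS]` with `K' = K + L/m`, `β' = β + ℓ/m`
  have hE' : ∀ s ∈ Icc t₀ tS, HasDerivWithinAt E (E' s) (Icc t₀ tS) s := fun s hs =>
    (hE s (hIsub hs)).mono hIsub
  have hV' : ∀ s ∈ Icc t₀ tS, HasDerivWithinAt V (V' s) (Icc t₀ tS) s := fun s hs =>
    (hV s (hIsub hs)).mono hIsub
  have hK' : 0 ≤ K + L / m := add_nonneg hK (div_nonneg hL hm.le)
  have hlow' : ∀ s ∈ Icc t₀ tS, 0 < E s → -(α * V s + (β + ℓ / m) * E s) ≤ E' s := by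
    intro s hs hEs
    have h1 := hlow s (hIsub hs) hEs
    have h2 : ℓ ≤ ℓ / m * E s := by
      rw [div_mul_eq_mul_div, le_div_iff₀ hm]
      exact mul_le_mul_of_nonneg_left (hEge s hs) hℓ
    nlinarith
  have hquot' : ∀ s ∈ Icc t₀ tS, 0 < E s →
      V' s * E s - V s * E' s ≤ (K + L / m) * (V s + E s) * E s := by
    intro s hs hEs
    have h1 := hquot s (hIsub hs) hEs
    have hVs : 0 ≤ V s := hV0 s (hIsub hs)
    have h2 : L ≤ L / m * (V s + E s) := by
      rw [div_mul_eq_mul_div, le_div_iff₀ hm]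
      exact mul_le_mul_of_nonneg_left (by linarith [hEge s hs]) hL
    have h3 : (K * (V s + E s) + L) * E s ≤ (K + L / m) * (V s + E s) * E s := by
      apply mul_le_mul_of_nonneg_right _ hEs.le
      nlinarith
    exact h1.trans h3
  have hmain := mul_exp_neg_le_of_dirichletQuotient_law_uniform (a := t₀) (b := tS) (τ := τ)
    hE' hV' (fun s hs => hE0 s (hIsub hs)) (fun s hs => hV0 s (hIsub hs)) hK' hα hlow' hquot'
    (left_mem_Icc.2 ht₀tS.le) (hEpos' t₀ (left_mem_Icc.2 ht₀tS.le)) (right_mem_Icc.2 ht₀tS.le) ht₀tS.le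
    (by linarith)
  -- compare the two rates: `|β + ℓ/m| ≤ |β| + ℓ/m`
  have hβ : |β + ℓ / m| ≤ |β| + ℓ / m := by
    have := abs_add_le β (ℓ / m)
    rwa [abs_of_nonneg (div_nonneg hℓ hm.le)] at this
  have hcmp : E t₀ * Real.exp (-((α * ((V t₀ / E t₀ + 1) * Real.exp ((K + L / m) * τ)) + |β| + ℓ / m) * τ))
      ≤ E t₀ * Real.exp (-((α * ((V t₀ / E t₀ + 1) * Real.exp ((K + L / m) * τ)) + |β + ℓ / m|) * τ)) := by
    refine mul_le_mul_of_nonneg_left (Real.exp_le_exp.2 ?_) (hE0 t₀ ht₀)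
    have hA : 0 ≤ α * ((V t₀ / E t₀ + 1) * Real.exp ((K + L / m) * τ)) :=
      mul_nonneg hα (mul_nonneg hΛ0nn (Real.exp_pos _).le)
    nlinarith
  have : m < E tS := lt_of_lt_of_le (lt_of_lt_of_le hfloor hcmp) hmain
  exact absurd hEtS (not_le.2 this)

end Summit.NavierStokesRegularity.NavierStokesRegularity.Cruxes.TypeIQuantSubcubicExp.SilencingCost

end
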